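import Literature.Computability.Learning.IWPadGeneratorFools
import Literature.Computability.Complexity.UniformDerandomizationEndgame
import HarnessLib

/-!
# Case `EXP ⊆ P/poly` of the hinge from the uniform reconstruction of the pad generator
# (Impagliazzo–Wigderson 1998, Lemmas 13–17 / Trevisan–Vadhan 2007, Thm. 3.9 with §4)

Consumer of `IWPadGeneratorFools.lean` (the discharge of `impagliazzoWigderson1998_samplable` reduced to
the single hypothesis of Case `EXP ⊆ P/poly`, `impagliazzoWigderson1998_samplable_of_caseB`) and of
`Complexity/UniformDerandomizationEndgame.lean` (under `EXP ⊆ P/poly` and `BPP ≠ EXP` no `PSPACE`-hard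
language is in `BPP`, `not_mem_BPP_of_isHard_PSPACE`). It plays the endgame with THIS development's
generator: in Case `EXP ⊆ P/poly` the hinge's generator is again `IWGen.iwGen k e c₀` — the Nisan–Wigderson
generator on the pad (`IWPadGenerator.lean`), now of an `EXP`-language `H` encoding a `PSPACE`-hard
language `L_f` (Trevisan–Vadhan: `H` = the amplified encoding of the downward-self-reducible and
self-correctible `PSPACE`-complete function of Thm. 4.3) — and the remaining obligation is isolated as the
explicit hypothesis `hLearn`, the **uniform reconstruction theorem** of Impagliazzo–Wigderson
(Lemmas 14–16, with the bootstrapping of Lemma 17 / Trevisan–Vadhan Lemmas 3.4–3.6: "if the generator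
built from `f` is distinguishable for almost all lengths by a uniform probabilistic test, then
`f ∈ BPP`"), stated for the tree's objects:

* **`hingeB_of_reconstruction`** — `IsHard PSPACE L_f`, `H ∈ DTIME(2^{n^b})` and `hLearn` give the hinge
  in Case `EXP ⊆ P/poly` (generator `iwGen k e (b+1)`, pad clause by construction, fooling clause by the
  endgame contradiction);
* **`impagliazzoWigderson1998_samplable_of_reconstruction`** (and the printed-class rendering
  `impagliazzoWigderson1998_of_reconstruction`) — hence the named facts from the existence of such a
  pair `(L_f, H)` with its reconstruction theorem: the discharge is now reduced to Impagliazzo–Wigderson's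
  main technical theorem ALONE (Trevisan–Vadhan Thm. 4.3 + Lemmas 3.4–3.6), every classical ingredient
  (BFNW, Meyer, `PH ⊆ PSPACE ⊆ EXP`, closure of `BPP`) being proved in the tree.

Everything is proved; no definitions, no named facts (the reconstruction theorem is a hypothesis of
proved theorems, D-0026).

## References

* [ImpagliazzoWigderson2001] R. Impagliazzo, A. Wigderson, JCSS 63 (2001), Thm. 5, §2.1, Lemmas 13–17.
* [TrevisanVadhan2007] L. Trevisan, S. Vadhan, Comput. Complexity 16 (2007), Lemmas 3.4–3.6, Thm. 3.9 (proof),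
  §4 Thm. 4.3.
* [VanMelkebeek2000] D. van Melkebeek, LNCS 1950 (2000), Thm. 6.2.1 (p. 142).
-/

noncomputable section

open Polynomial Filter

namespace Literature.Computability.Learning

open Literature.Computability.Complexity Literature.Computability.Complexity.UDerand
  Literature.Computability.MetaComplexity _root_.Computability

namespace IWGen

/-- **Case `EXP ⊆ P/poly` of the hinge from the uniform reconstruction theorem.** Let `L_f` be
`PSPACE`-hard, `H ∈ DTIME(2^{n^b})`, and assume (`hLearn`, Impagliazzo–Wigderson Lemmas 14–17 /
Trevisan–Vadhan Lemmas 3.4–3.6 for this pair): whenever the pad generator `iwGen k e c₀` IS the NW generator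
of `H` at all large lengths and some probabilistic polynomial-time test with exact coins tells it from
uniform with advantage `≥ ℓ^{−c}` at ALL large `ℓ`, then `L_f ∈ BPP`. Then under `EXP ⊆ P/poly` and
`BPP ≠ EXP` the hinge of `impagliazzoWigderson1998_samplable_of_uniformPRG` holds (with `c₀ = b + 1`,
`G = iwGen k e c₀`): otherwise `L_f ∈ BPP`, and the endgame `not_mem_BPP_of_isHard_PSPACE` refutes it.
[cite: ImpagliazzoWigderson2001, §2.1 and Lemma 17] [cite: TrevisanVadhan2007, Thm. 3.9 (proof)] -/
theorem hingeB_of_reconstruction {Lf H : Language Bool} {b : ℕ} (hHard : IsHard PSPACE Lf)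
    (hH : H ∈ DTIME (fun n => 2 ^ n ^ b))
    (hLearn : ∀ (k c₀ : ℕ) (e : List Bool), b < c₀ →
      (∀ᶠ ℓ in atTop, ∀ (σ : List Bool) (hσ : prmQ ℓ * prmQ ℓ ≤ σ.length),
          iwGen k e c₀ ℓ σ = List.ofFn (nwGenerator (designOf k ℓ) (H.sliceFn ℓ) (zOf ℓ σ hσ))) →
      ∀ T : RandAlg (List Bool) Bool, T.IsPolyTime id encodeBool →
        (∃ q : Polynomial ℕ, ∀ N, T.coinLen N = q.eval N) → ∀ c : ℕ,
          (∀ᶠ ℓ : ℕ in atTop, 1 / (ℓ : ℝ) ^ c ≤ |seedAvg c₀ k (iwGen k e c₀) T ℓ - unifAvg k T ℓ|) →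
            Lf ∈ BPP)
    (hPP : EXP ⊆ PPoly) (hne : BPP ≠ EXP) :
    ∃ c₀ : ℕ, ∀ k : ℕ, ∃ G : ℕ → List Bool → List Bool,
      (∃ F ∈ FP, ∀ (ℓ : ℕ) (σ : List Bool), σ.length = ℓ ^ c₀ →
          F (ones (2 ^ ℓ ^ c₀) ++ false :: boolPair (ones ℓ) σ) = G ℓ σ) ∧
      ∀ T : RandAlg (List Bool) Bool, T.IsPolyTime id encodeBool →
        (∃ q : Polynomial ℕ, ∀ N, T.coinLen N = q.eval N) → ∀ c : ℕ,
          ∃ᶠ ℓ : ℕ in atTop, |seedAvg c₀ k G T ℓ - unifAvg k T ℓ| < 1 / (ℓ : ℝ) ^ c := by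
  refine ⟨b + 1, fun k => ?_⟩
  obtain ⟨e, he⟩ := eventually_iwGen_eq_ofFn_nwGenerator k hH (Nat.lt_succ_self b)
  refine ⟨iwGen k e (b + 1), iwGen_pad k e (b + 1), fun T hT hq c => ?_⟩
  by_contra hnot
  rw [Filter.not_frequently] at hnot
  have hge : ∀ᶠ ℓ : ℕ in atTop, 1 / (ℓ : ℝ) ^ c ≤ |seedAvg (b + 1) k (iwGen k e (b + 1)) T ℓ - unifAvg k T ℓ| :=
    hnot.mono fun ℓ h => not_lt.1 h
  exact not_mem_BPP_of_isHard_PSPACE hPP hne hHard (hLearn k (b + 1) e (Nat.lt_succ_self b) he T hT hq c hge)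

/-- **The discharge of `impagliazzoWigderson1998_samplable` reduced to Impagliazzo–Wigderson's uniform
reconstruction theorem alone**: it holds as soon as some `PSPACE`-hard `L_f` and some
`H ∈ DTIME(2^{n^b})` satisfy the reconstruction hypothesis of `hingeB_of_reconstruction`
(Trevisan–Vadhan: `L_f` the downward-self-reducible, self-correctible `PSPACE`-complete problem of
Thm. 4.3, `H` its amplified encoding; Lemmas 3.4–3.6). Case `EXP ⊄ P/poly` is
`uniformPRG_of_not_EXP_subset_PPoly`. [cite: VanMelkebeek2000, Thm. 6.2.1] [cite: ImpagliazzoWigderson2001, Thm. 5]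
[cite: TrevisanVadhan2007, Thm. 3.9 and Thm. 4.3] -/
theorem impagliazzoWigderson1998_samplable_of_reconstruction
    (h : ∃ (Lf H : Language Bool) (b : ℕ), IsHard PSPACE Lf ∧ H ∈ DTIME (fun n => 2 ^ n ^ b) ∧
      ∀ (k c₀ : ℕ) (e : List Bool), b < c₀ →
        (∀ᶠ ℓ in atTop, ∀ (σ : List Bool) (hσ : prmQ ℓ * prmQ ℓ ≤ σ.length),
            iwGen k e c₀ ℓ σ = List.ofFn (nwGenerator (designOf k ℓ) (H.sliceFn ℓ) (zOf ℓ σ hσ))) →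
        ∀ T : RandAlg (List Bool) Bool, T.IsPolyTime id encodeBool →
          (∃ q : Polynomial ℕ, ∀ N, T.coinLen N = q.eval N) → ∀ c : ℕ,
            (∀ᶠ ℓ : ℕ in atTop, 1 / (ℓ : ℝ) ^ c ≤ |seedAvg c₀ k (iwGen k e c₀) T ℓ - unifAvg k T ℓ|) →
              Lf ∈ BPP) :
    impagliazzoWigderson1998_samplable :=
  impagliazzoWigderson1998_samplable_of_caseB fun hPP hne => by
    obtain ⟨Lf, H, b, hHard, hH, hLearn⟩ := h
    exact hingeB_of_reconstruction hHard hH hLearn hPP hne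

/-- The same for the printed-class rendering `impagliazzoWigderson1998`. [cite: VanMelkebeek2000, Thm. 6.2.1]
[cite: ImpagliazzoWigderson2001, Thm. 5] -/
theorem impagliazzoWigderson1998_of_reconstruction
    (h : ∃ (Lf H : Language Bool) (b : ℕ), IsHard PSPACE Lf ∧ H ∈ DTIME (fun n => 2 ^ n ^ b) ∧
      ∀ (k c₀ : ℕ) (e : List Bool), b < c₀ →
        (∀ᶠ ℓ in atTop, ∀ (σ : List Bool) (hσ : prmQ ℓ * prmQ ℓ ≤ σ.length),
            iwGen k e c₀ ℓ σ = List.ofFn (nwGenerator (designOf k ℓ) (H.sliceFn ℓ) (zOf ℓ σ hσ))) →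
        ∀ T : RandAlg (List Bool) Bool, T.IsPolyTime id encodeBool →
          (∃ q : Polynomial ℕ, ∀ N, T.coinLen N = q.eval N) → ∀ c : ℕ,
            (∀ᶠ ℓ : ℕ in atTop, 1 / (ℓ : ℝ) ^ c ≤ |seedAvg c₀ k (iwGen k e c₀) T ℓ - unifAvg k T ℓ|) →
              Lf ∈ BPP) :
    impagliazzoWigderson1998 :=
  impagliazzoWigderson1998_of_caseB fun hPP hne => by
    obtain ⟨Lf, H, b, hHard, hH, hLearn⟩ := h
    exact hingeB_of_reconstruction hHard hH hLearn hPP hne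

end IWGen

end Literature.Computability.Learning

end
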